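import Literature.MathematicalPhysics.QuantumFieldTheory.Balaban1983to89.Node00.Record12Residuals

/-!
# NODE 00 (YM-PLAN Track A) — STAGE 12, FILE 12c⁗ (K0b FILE 4): ROW P11 `bg` READ DOWN AT THE RESIDUAL §2 DATA OF RECORD —
# what the unit recipe `RzOfRecord = Sect2.Residual.unit` does to the background proviso, and the two small-field conditions on def-R's
# background of record that remain

Cell `pub-ymgap`, NODE 00, K0′-components seat `pub-ymgap-node00-def-K0b` (g4); K0′ = `Record12Inhabited` = stmt-QuantumFields-19902; row P11 of the dag-lead's
§ K0′ component table («`bg` — OWNER TBD»).  [I] = [Balaban1987RG1] (CMP 109), [III] = [Balaban1988Convergent] (CMP 119; journal page = PDF page + 242).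
Written against def-T's `Node00.Record12` v2.3 (`Provisos₁₂.bg`), 11b's `Node00.Sect2FrameOfRecord` (`spaceI`, `spaceMS`, `frameI`, `frameMS`, `Residual`),
11c's `Node00.Sect2FormOfRecord` (`BgProviso`, `Residual.Laws`, `Setting.Pos`), r11's `B12RegularSpaces111` ∕ `B14RegularSpaces234` (conditions (i)–(iv) of
[I] (1.11)–(1.16) and (i)–(iii) of [III] (2.34)–(2.39)) and this seat's FILE 1 `Node00.Record12Residuals` (`RzOfRecord`, `HasResidualsOfRecord`) — the only import;
K0a's `Node00.Record12LiveSelector` (`theta12LiveOfRecord`, `hasResidualsOfRecord_theta12LiveOfRecord`) is cited, not imported.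

WHAT THIS FILE PROVES (theorems only).  The field `Provisos₁₂.bg` (row P11) demands, for every run `p`, length `n ≤ K` inside the coupling window, sequence `s`,
retained configuration `𝐖 ∈ suppOfRecord₁₂`, scale `1 ≤ j ≤ n` and domain `X ∈ 𝐃_j`, that def-R's background of record `U = UbgOfRecord₁₂ θ p n s 𝐖`, read in
`Φ` through `ι : SU(N) → GL_N(ℂ)` with `𝐉 = 0`, lies in `U^c_j(X, α_{0,j}, α_{1,j})` ([I] (1.11)–(1.16)) AND in `Ũ^c_j(X, α̃₀, α̃₁)` ([III] (2.34)–(2.39)) OF RECORD —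
the spaces built on the frame whose complex background FUNCTIONS `U_n(M˙(·)), J_n(M˙(·))` ((I.1.15)) and `U_{p,X}(M˙(·)), 𝐉_{p,X}(M˙(·))` ((2.35), (2.37)) are the
RESIDUAL §2 data `θ.Rz`.  At K0b's residual of record (`HasResidualsOfRecord θ`: `θ.Rz = RzOfRecord F N`, the UNIT recipe) this file shows:
* §1 (any residual) the two memberships PULL BACK to r11's predicates on the units-valued pair `⟨ι ∘ U, 0⟩` (`embedPair` is injective):
  `ofBackgroundC_mem_spaceI_iff`, `ofBackgroundC_mem_spaceMS_iff`.
* §2 AT THE UNIT RECIPE condition (iv) (I.1.16) holds for EVERY configuration (`Residual.condIV_unit`: its left sides are `‖∂1 − 1‖ = 0` and `‖0‖`), so the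
  four-condition predicate `Satisfies` IS the three-condition one `SatisfiesI_III` (`Residual.satisfies_frameI_unit_iff`) and `U^c_j` of record is the union of
  `Gᶜ`-orbits of pairs satisfying (i)–(iii) ONLY (`Residual.mem_space_frameI_unit_iff`); and in [III]'s condition (i) the (2.35)∕(2.37) clauses range over the
  EMPTY layer regions of the unit recipe, so `CondI234` IS «`U` is `G`-valued on `X`» ∧ (2.34) for `U` ∧ (2.34) for `𝐔` ∧ (2.36) for `𝐉`
  (`Residual.condI234_frameMS_unit_iff`).  CORRECTION of FILE 1's header (viii) («(2.34)–(2.37) VACUOUS»): (2.35) and (2.37) are void, (2.34) and (2.36) are NOT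
  (the layers `X ∩ (Ω_n ∖ Ω_{n+1})` come from the SEQUENCE, not from the residual).
* §3 for a REAL background `U` (factorisation `𝐔 = (exp iξ·0)·U`, `A′ = 0`, gauge `u = 1`, `𝐉 = 0`): [I]-membership ⟸ condition (i) `CondI` of (1.11)–(1.12) for
  `ι ∘ U` alone (`Residual.ofBackgroundC_mem_spaceI_unit_of_condI`); [III]-membership ⟸ (2.34) for `ι ∘ U` on the layers ∧ (2.38) `CondII238` for `ι ∘ U`
  (`Residual.ofBackgroundC_mem_spaceMS_unit_of_conds`) — (ii)∕(iii)∕(2.36)∕(2.39) then hold with left side `0` at positive radii; hence `BgProviso` at the unit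
  recipe ⟸ these, per `(s, 𝐖, j, X)` (`bgProviso_unit_of_conds`).
* §4 AT THE RECORD: for ANY `θ : Stage12Params` with `HasResidualsOfRecord θ` and `Admissible θ` (radii `0 < α_{0,j}, α_{1,j}` inside the window by 12b's
  `alphaPos₁₂_of_inInterval`, signs by `settingOfRecord₁₂_pos ∕ _laws`): ★ `Stage12Params.HasResidualsOfRecord.bg_of_conds` — ROW P11's FIELD VERBATIM ⟸ the
  displayed hypotheses (hI) [I] (1.11)–(1.12) and (h234)∕(h238) [III] (2.34)∕(2.38) for `ι ∘ UbgOfRecord₁₂ θ p n s 𝐖`.  It applies BY NAME at K0a's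
  `θ₀ = theta12OfRecord F N (zeta316OfRecord …) (RzOfRecord F N) (ZtOfRecord F N)` (`(⟨rfl, rfl, rfl⟩ : θ₀.HasResidualsOfRecord F N).bg_of_conds
  (admissible_theta12OfRecord F N _ _ _)`) and at `θ₀ˡⁱᵛᵉ = theta12LiveOfRecord …` (`(hasResidualsOfRecord_theta12LiveOfRecord F N).bg_of_conds
  (admissible_theta12LiveOfRecord F N _ _ _)`), feeding K0c's `provisos₁₂_theta12LiveOfRecord_of_base (hbase) (hbg)` (plan skeleton v4-LIVE `stub_resid12Live`).

NET (for the § K0′ board; count-neutral).  At the K0′ witness, ROW P11 = «def-R's minimiser background `UbgMSOfRecord` (levels `n ≥ 1`; at `n = 0` the proviso is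
empty, 12b `bgProviso_zero`) has SMALL PLAQUETTE VARIABLES and SMALL LOCAL AXIAL GAUGES at the (2.28) radii on every localization domain and every layer, for every
retained `𝐖`» — print's [15] Thm 1 ∕ (2.7) regularity of the background field, and NOTHING about complex background functions: the comparisons (I.1.16), (2.35),
(2.37) with [14]∕[15]'s analytic continuations DROP OUT at the unit recipe (FILE 1 LOCATED-R1 (C3): what print's `Rz` would add back).  This is the row's START
LINE for whichever seat the director names, and the referees' vacuity datum for K0b's residual.

HONEST SCOPE.  Bookkeeping over r11 ∕ 11b ∕ 11c ∕ 12b ∕ FILE 1 ∕ K0a by name (`rfl`, `Function.Injective.mem_set_image`, positivity of the printed radii).  The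
hypotheses (hI), (h234), (h238) are DISPLAYED, never asserted; nothing of Bałaban's is asserted; row P11 is NOT discharged; K0′ is NOT discharged; counts unmoved
(typed 28∕28 · discharged 5∕28); one finite torus at fixed `ε = L^{−K}` — not continuum ∕ ℝ⁴ ∕ OS ∕ mass-gap ∕ Clay.  No `sorry`, no `axiom`, no `def`, no
`instance`, no `notation`.
-/

noncomputable section

open MeasureTheory
open scoped BigOperators Matrix.Norms.L2Operator

namespace Literature.MathematicalPhysics.QuantumFieldTheory.Balaban1983to89.Node00

open Literature.MathematicalPhysics.QuantumFieldTheory.Balaban1983to89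
open B12RegularSpaces111 B14RegularSpaces234 B14Radii T4Continuum B14.Eq218Concrete

namespace Sect2

/-! ## §1  Pull-back of the two memberships to r11's predicates on units-valued pairs (any residual) -/

section PullBack

variable {P : Params} {𝔸 : Type*} [NormedRing 𝔸] [NormedAlgebra ℂ 𝔸] [CompleteSpace 𝔸]

omit [NormedAlgebra ℂ 𝔸] [CompleteSpace 𝔸] in
/-- Units-valued pairs are read faithfully in `Φ` (`Units.val` is injective). [cite: Balaban1987RG1, (1.9)–(1.10) p.262 (bookkeeping)] -/
theorem embedPair_injective : Function.Injective (embedPair (P := P) (𝔸 := 𝔸)) := by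
  rintro ⟨U, J⟩ ⟨U', J'⟩ h
  have hU : ∀ b, (U b : 𝔸) = U' b := fun b => congrFun (congrArg Prod.fst h) b
  have hJ : J = J' := congrArg Prod.snd h
  obtain rfl : U = U' := funext fun b => Units.ext (hU b)
  subst hJ
  rfl

omit [NormedAlgebra ℂ 𝔸] [CompleteSpace 𝔸] in
/-- A real background read in `Φ` IS the embedded units-valued pair `(ι ∘ U, 0)` (`rfl`). [cite: Balaban1988Convergent, (2.27)(ii) p.259 (bookkeeping)] -/
theorem ofBackgroundC_eq_embedPair {G : Type*} [Group G] (ι : G →* 𝔸ˣ) (U : GaugeField P 0 G) :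
    ofBackgroundC ι U = embedPair (⟨fun b => ι (U b), fun _ => 0⟩ : FieldPair P 0 𝔸ˣ 𝔸) := rfl

variable {G : Type*} [Group G]

/-- **PULL-BACK OF THE [I]-MEMBERSHIP**: the background `U` read in `Φ` lies in `U^c_j(X, α₀, α₁)` of record iff the units-valued pair `(ι ∘ U, 0)` lies in r11's
`B12RegularSpaces111.space'` on the frame of record. [cite: Balaban1987RG1, (1.11)–(1.16) p.262; Balaban1988Convergent, (2.28) p.259] -/
theorem ofBackgroundC_mem_spaceI_iff (S : Setting 𝔸 G) (Rz : Residual P 𝔸) (M j : ℕ) (Y : Set (Site P 0)) (α₀ α₁ : ℝ) (U : GaugeField P 0 G) :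
    ofBackgroundC S.ι U ∈ spaceI S Rz M j Y α₀ α₁ ↔
      (⟨fun b => S.ι (U b), fun _ => 0⟩ : FieldPair P 0 𝔸ˣ 𝔸) ∈ space' S.𝓜 (frameI Rz M j Y) (StepConsts.ofParams P S.cB j) α₀ α₁ := by
  rw [ofBackgroundC_eq_embedPair]
  exact embedPair_injective.mem_set_image

/-- **PULL-BACK OF THE [III]-MEMBERSHIP**: the background `U` read in `Φ` lies in `Ũ^c_j(X, α̃₀, α̃₁)` of record iff the units-valued pair `(ι ∘ U, 0)` satisfies
r11's three conditions `B14RegularSpaces234.Satisfies234` on the multi-scale frame of record, with the radii `α_{0,n} = α₀(g_n)`, `α_{1,n} = α₁(g_n)` of (2.28).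
[cite: Balaban1988Convergent, (2.34)–(2.39) p.261, (2.28) p.259] -/
theorem ofBackgroundC_mem_spaceMS_iff (S : Setting 𝔸 G) (Rz : Residual P 𝔸) (M j : ℕ) (Y : Set (Site P 0)) (Ω : ℕ → Set (Site P 0)) (U : GaugeField P 0 G) :
    ofBackgroundC S.ι U ∈ spaceMS S Rz M j Y Ω ↔
      Satisfies234 S.𝓜 (frameMS Rz M j Y Ω) (MSConsts.ofParams P S.βc S.B S.C S.Mr j) (fun n => S.lf.alpha0 (S.flow.g n))
        (fun n => S.lf.alpha1 (S.flow.g n)) (⟨fun b => S.ι (U b), fun _ => 0⟩ : FieldPair P 0 𝔸ˣ 𝔸) := by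
  rw [ofBackgroundC_eq_embedPair]
  exact embedPair_injective.mem_set_image

end PullBack

/-! ## §2  The unit recipe: (I.1.16) holds for every configuration; (2.35), (2.37) range over empty regions -/

section Unit

variable {P : Params} {𝔸 : Type*} [NormedRing 𝔸] [NormedAlgebra ℂ 𝔸] [CompleteSpace 𝔸]

/-- The unit recipe's (I.1.15) background function is the constant unit configuration (`rfl`). [cite: Balaban1987RG1, (1.15) p.262 (the slot; bookkeeping)] -/
theorem Residual.unit_bgI_Un (j : ℕ) (Y : Set (Site P 0)) (n : ℕ) (V : PBond P 0 → 𝔸ˣ) : ((Residual.unit P 𝔸).bgI j Y).Un n V = 1 := rfl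

/-- The unit recipe's (I.1.15) current function vanishes (`rfl`). [cite: Balaban1987RG1, (1.15) p.262 (the slot; bookkeeping)] -/
theorem Residual.unit_bgI_Jn (j : ℕ) (Y : Set (Site P 0)) (n : ℕ) (V : PBond P 0 → 𝔸ˣ) (b : PBond P 0) : ((Residual.unit P 𝔸).bgI j Y).Jn n V b = 0 := rfl

/-- The unit recipe's (2.35)∕(2.37) layer regions are those of the EMPTY site set (`rfl`). [cite: Balaban1988Convergent, (2.35) p.261 (the slot; bookkeeping)] -/
theorem Residual.unit_bgMS_layer (j : ℕ) (Y : Set (Site P 0)) (p n : ℕ) : ((Residual.unit P 𝔸).bgMS j Y).layer p n = regionOfSet P ∅ := rfl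

/-- The region of the empty site set has no plaquettes. [cite: Balaban1987RG1, (1.11) p.262 («on X»; bookkeeping)] -/
theorem notMem_plaqs_regionOfSet_empty (q : Plaq P 0) : q ∉ (regionOfSet P (∅ : Set (Site P 0))).plaqs :=
  fun hq => absurd hq.1 (Set.notMem_empty _)

/-- The region of the empty site set has no bonds. [cite: Balaban1987RG1, (1.13) p.262 («on X»; bookkeeping)] -/
theorem notMem_bonds_regionOfSet_empty (b : PBond P 0) : b ∉ (regionOfSet P (∅ : Set (Site P 0))).bonds :=
  fun hb => absurd hb.1 (Set.notMem_empty _)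

/-- **(I.1.16) IS VOID AT THE UNIT RECIPE**: condition (iv) holds for EVERY configuration `V` as soon as `α₀ > 0` and `ξ, L ≠ 0` (its left sides are
`‖∂1 − 1‖ = 0` and `‖0‖ = 0`). [cite: Balaban1987RG1, (1.15)–(1.16) p.262] -/
theorem Residual.condIV_unit (j : ℕ) (Y : Set (Site P 0)) (X₂ : Region P 0) {c : StepConsts} (hξ : c.ξ ≠ 0) (hL : c.L ≠ 0) {α₀ : ℝ} (h₀ : 0 < α₀)
    (V : PBond P 0 → 𝔸ˣ) : CondIV ((Residual.unit P 𝔸).bgI j Y) X₂ c α₀ V := by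
  refine ⟨fun n _ _ p _ => ?_, fun n _ _ b _ => ?_⟩
  · rw [Residual.unit_bgI_Un, B12RegularSpaces111Mono.plaq_one, Units.val_one, sub_self, norm_zero]
    exact mul_pos h₀ (by positivity)
  · rw [Residual.unit_bgI_Jn, norm_zero]
    exact mul_pos h₀ (by positivity)

/-- **AT THE UNIT RECIPE THE FOUR CONDITIONS ARE THE THREE**: `Satisfies` (i)–(iv) ⟺ `SatisfiesI_III` (i)–(iii) on the [I]-frame of record (positive `α₀`,
`ξ, L ≠ 0`). [cite: Balaban1987RG1, (1.11)–(1.16) p.262] -/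
theorem Residual.satisfies_frameI_unit_iff (𝓜 : Model 𝔸) (M j : ℕ) (Y : Set (Site P 0)) {c : StepConsts} (hξ : c.ξ ≠ 0) (hL : c.L ≠ 0) {α₀ α₁ γ₀ : ℝ}
    (h₀ : 0 < α₀) (Φ : FieldPair P 0 𝔸ˣ 𝔸) :
    Satisfies 𝓜 (frameI (Residual.unit P 𝔸) M j Y) c α₀ α₁ γ₀ Φ ↔ SatisfiesI_III 𝓜 (frameI (Residual.unit P 𝔸) M j Y) c α₀ α₁ γ₀ Φ := by
  refine ⟨Satisfies.toI_III 𝓜, fun h => ?_⟩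
  obtain ⟨hG, hg, U, A', hf, h1, h2, h3⟩ := h
  exact ⟨hG, hg, U, A', hf, h1, h2, h3, Residual.condIV_unit j Y _ hξ hL h₀ _, Residual.condIV_unit j Y _ hξ hL h₀ _⟩

/-- **`U^c_j(X, α₀, α₁, γ₀)` OF RECORD AT THE UNIT RECIPE = THE UNION OF `Gᶜ`-ORBITS OF PAIRS SATISFYING (i)–(iii) ONLY** — print's space WITHOUT its condition (iv):
the junk direction of the unit residual is ENLARGEMENT. [cite: Balaban1987RG1, (1.11)–(1.16) p.262, (1.19) p.263] -/
theorem Residual.mem_space_frameI_unit_iff (𝓜 : Model 𝔸) (M j : ℕ) (Y : Set (Site P 0)) {c : StepConsts} (hξ : c.ξ ≠ 0) (hL : c.L ≠ 0) {α₀ α₁ γ₀ : ℝ}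
    (h₀ : 0 < α₀) (Φ : FieldPair P 0 𝔸ˣ 𝔸) :
    Φ ∈ space 𝓜 (frameI (Residual.unit P 𝔸) M j Y) c α₀ α₁ γ₀ ↔
      ∃ (u : Site P 0 → 𝔸ˣ) (Φ₀ : FieldPair P 0 𝔸ˣ 𝔸), (∀ x, u x ∈ 𝓜.Gc) ∧ SatisfiesI_III 𝓜 (frameI (Residual.unit P 𝔸) M j Y) c α₀ α₁ γ₀ Φ₀ ∧ Φ = act u Φ₀ := by
  constructor
  · rintro ⟨u, Φ₀, hu, h, rfl⟩
    exact ⟨u, Φ₀, hu, (Residual.satisfies_frameI_unit_iff 𝓜 M j Y hξ hL h₀ Φ₀).mp h, rfl⟩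
  · rintro ⟨u, Φ₀, hu, h, rfl⟩
    exact ⟨u, Φ₀, hu, (Residual.satisfies_frameI_unit_iff 𝓜 M j Y hξ hL h₀ Φ₀).mpr h, rfl⟩

/-- **[III]'s CONDITION (i) AT THE UNIT RECIPE**: the (2.35)∕(2.37) clauses range over the EMPTY layer regions, so `CondI234` IS «`U` is `G`-valued on `X`» ∧ (2.34)
for `U` ∧ (2.34) for `𝐔` ∧ (2.36) for `𝐉` — the comparisons with the complex background functions `U_{p,X}(M˙(𝐔))`, `𝐉_{p,X}(M˙(𝐔))` drop out; (2.34)∕(2.36) do NOT.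
[cite: Balaban1988Convergent, (2.34)–(2.37) p.261] -/
theorem Residual.condI234_frameMS_unit_iff (𝓜 : Model 𝔸) (M j : ℕ) (Y : Set (Site P 0)) (Ω : ℕ → Set (Site P 0)) (c : MSConsts) (α₀ : ℕ → ℝ)
    (U : PBond P 0 → 𝔸ˣ) (Φ : FieldPair P 0 𝔸ˣ 𝔸) :
    CondI234 𝓜 (frameMS (Residual.unit P 𝔸) M j Y Ω) c α₀ U Φ ↔
      (∀ b ∈ (regionOfSet P Y).bonds, U b ∈ 𝓜.G) ∧
      (∀ n, 1 ≤ n → n ≤ c.j → ∀ p ∈ (regionOfSet P (layerSet j Y Ω n)).plaqs, ‖(↑(plaq U p) : 𝔸) - 1‖ < rad234 c.β (α₀ n) c.ξ c.L c.j n) ∧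
      (∀ n, 1 ≤ n → n ≤ c.j → ∀ p ∈ (regionOfSet P (layerSet j Y Ω n)).plaqs, ‖(↑(plaq Φ.U p) : 𝔸) - 1‖ < rad234 c.β (α₀ n) c.ξ c.L c.j n) ∧
      (∀ n, 1 ≤ n → n ≤ c.j → ∀ b ∈ (regionOfSet P (layerSet j Y Ω n)).bonds, ‖Φ.J b‖ < rad236 c.β (α₀ n) c.ξ c.L c.j n) := by
  refine ⟨fun h => ⟨h.gValued, h.plaq_lt, h.plaqU_lt, h.J_lt⟩, fun ⟨hG, hU, hUc, hJ⟩ => ⟨hG, hU, hUc, ?_, hJ, ?_⟩⟩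
  · exact fun p _ _ n _ _ q hq => absurd hq (notMem_plaqs_regionOfSet_empty q)
  · exact fun p _ _ n _ _ b hb => absurd hb (notMem_bonds_regionOfSet_empty b)

end Unit

/-! ## §3  Sufficient conditions for a REAL background (`𝐔 = (exp iξ·0)·U`, `A′ = 0`, `u = 1`, `𝐉 = 0`) -/

section Real

variable {P : Params} {𝔸 : Type*} [NormedRing 𝔸] [NormedAlgebra ℂ 𝔸] [CompleteSpace 𝔸] {G : Type*} [Group G]

/-- `ξ = L^{−j} ≠ 0` and `L ≠ 0` for the constants over `Setup.Params`. [cite: Balaban1987RG1, (0.1) p.251, (1.11) p.262 (bookkeeping)] -/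
theorem stepConsts_ofParams_ne_zero (cB : ℝ) (j : ℕ) : (StepConsts.ofParams P cB j).ξ ≠ 0 ∧ (StepConsts.ofParams P cB j).L ≠ 0 :=
  ⟨(pow_pos (inv_pos.mpr (Nat.cast_pos.mpr P.L_pos)) j).ne', L_cast_ne_zero P⟩

/-- **[I]-MEMBERSHIP OF A REAL BACKGROUND AT THE UNIT RECIPE ⟸ CONDITION (i) ALONE**: if `ι ∘ U` satisfies (1.11)–(1.12) on the frame of record (`G`-valued,
`|∂U − 1| < α₀ξ²` on `X`, a small local gauge on every cube of (1.12)), then `(ι ∘ U, 0) ∈ U^c_j(X, α₀, α₁)` of record — with the factorisation `𝐔 = (exp iξ·0)·U`,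
(ii) for `A′ = 0`, (iii) = (1.11) again and `|0| < α₀`, (iv) void (§2), own orbit `u = 1`.  Needs only the model laws (`ι(G) ⊂ G ≤ Gᶜ`) and `0 < α₀, α₁`
(`O(1)LMB` enters through `CondI` itself). [cite: Balaban1987RG1, (1.11)–(1.16) p.262; Balaban1988Convergent, (2.28) p.259] -/
theorem Residual.ofBackgroundC_mem_spaceI_unit_of_condI (S : Setting 𝔸 G) (hS : S.Laws) (M j : ℕ) (Y : Set (Site P 0)) {α₀ α₁ : ℝ} (h₀ : 0 < α₀)
    (h₁ : 0 < α₁) (U : GaugeField P 0 G)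
    (hI : CondI S.𝓜 (frameI (Residual.unit P 𝔸) M j Y) (StepConsts.ofParams P S.cB j) α₀ (fun b => S.ι (U b))) :
    ofBackgroundC S.ι U ∈ spaceI S (Residual.unit P 𝔸) M j Y α₀ α₁ := by
  rw [ofBackgroundC_mem_spaceI_iff]
  obtain ⟨hξ, hL⟩ := stepConsts_ofParams_ne_zero (P := P) S.cB j
  refine mem_space_of_satisfies ⟨fun b _ => hS.G_le_Gc (hS.ι_mem (U b)), fun _ _ => S.𝓜.gc.zero_mem, fun b => S.ι (U b), fun _ => 0,
    fun b => by rw [B12RegularSpaces111Mono.expI_zero, one_mul], hI, B12RegularSpaces111Mono.condII_zero _ _ h₁ _, ⟨hI.plaq_lt, fun b _ => ?_⟩,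
    Residual.condIV_unit j Y _ hξ hL h₀ _, Residual.condIV_unit j Y _ hξ hL h₀ _⟩
  show ‖(0 : 𝔸)‖ < α₀
  rw [norm_zero]
  exact h₀

end Real

section RealMS

variable {P : Params} {𝔸 : Type*} [NormedRing 𝔸] [NormedAlgebra ℂ 𝔸] [CompleteSpace 𝔸] {G : Type*} [GaugeGroup G]

/-- `0 < L` and `0 < ξ = L^{−j}` over `Setup.Params`. [cite: Balaban1987RG1, (0.1) p.251 (bookkeeping)] -/
theorem L_cast_pos_and_eta_pos (P : Params) (j : ℕ) : (0 : ℝ) < P.L ∧ 0 < P.eta j :=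
  ⟨Nat.cast_pos.mpr P.L_pos, pow_pos (inv_pos.mpr (Nat.cast_pos.mpr P.L_pos)) j⟩

/-- **[III]-MEMBERSHIP OF A REAL BACKGROUND AT THE UNIT RECIPE ⟸ (2.34) AND (2.38) FOR `ι ∘ U`**: if `ι ∘ U` has (2.34)-small plaquette variables on every layer
`X ∩ (Ω_n ∖ Ω_{n+1})` (`1 ≤ n < j`), `X ∩ Ω_j` (`n = j`), and the (2.38) local gauges on the layer cubes (`CondII238`), then `(ι ∘ U, 0) ∈ Ũ^c_j(X, α̃₀, α̃₁)` of
record — (i)'s remaining clauses: `G`-valued by the model laws, (2.35)∕(2.37) void (§2), (2.36) `‖0‖ <` a positive radius; (iii) for `A′ = 0`.  Needs the signs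
`0 ≤ β < 1` of the setting and positive radii `α_{0,n}, α_{1,n}` for `1 ≤ n ≤ j`. [cite: Balaban1988Convergent, (2.34)–(2.39) p.261, (2.28) p.259] -/
theorem Residual.ofBackgroundC_mem_spaceMS_unit_of_conds (S : Setting 𝔸 G) (hS : S.Laws) (hpos : S.Pos) (M j : ℕ) (Y : Set (Site P 0))
    (Ω : ℕ → Set (Site P 0)) (hα₀ : ∀ n, 1 ≤ n → n ≤ j → 0 < S.lf.alpha0 (S.flow.g n)) (hα₁ : ∀ n, 1 ≤ n → n ≤ j → 0 < S.lf.alpha1 (S.flow.g n))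
    (U : GaugeField P 0 G)
    (h234 : ∀ n, 1 ≤ n → n ≤ j → ∀ q ∈ (regionOfSet P (layerSet j Y Ω n)).plaqs,
      ‖(↑(plaq (fun b => S.ι (U b)) q) : 𝔸) - 1‖ < rad234 S.βc (S.lf.alpha0 (S.flow.g n)) (P.eta j) P.L j n)
    (h238 : CondII238 S.𝓜 (frameMS (Residual.unit P 𝔸) M j Y Ω) (MSConsts.ofParams P S.βc S.B S.C S.Mr j) (fun n => S.lf.alpha0 (S.flow.g n))
      (fun b => S.ι (U b))) :
    ofBackgroundC S.ι U ∈ spaceMS S (Residual.unit P 𝔸) M j Y Ω := by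
  rw [ofBackgroundC_mem_spaceMS_iff]
  obtain ⟨hL, hξ⟩ := L_cast_pos_and_eta_pos P j
  have h0 : 0 ≤ S.βc := hpos.βc_nonneg
  have h1 : S.βc < 1 := hpos.βc_lt_one
  refine ⟨fun b _ => hS.G_le_Gc (hS.ι_mem (U b)), fun _ _ => S.𝓜.gc.zero_mem, fun b => S.ι (U b), fun _ => 0,
    fun b => by rw [B12RegularSpaces111Mono.expI_zero, one_mul], ?_, h238, ?_⟩
  · refine ⟨fun b _ => hS.ι_mem (U b), h234, h234, fun p _ _ n _ _ q hq => absurd hq (notMem_plaqs_regionOfSet_empty q),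
      fun n hn hnj b _ => ?_, fun p _ _ n _ _ b hb => absurd hb (notMem_bonds_regionOfSet_empty b)⟩
    show ‖(0 : 𝔸)‖ < _
    rw [norm_zero]
    exact B14RegularSpaces234Inner.rad236_pos h0 h1 (hα₀ n hn hnj) hL hξ
  · refine ⟨fun _ _ => S.𝓜.gc.zero_mem, fun n hn hnj b _ => ?_, fun n hn hnj q _ => ?_⟩
    · simp only [norm_zero, mul_zero]
      exact mul_pos (shrink_pos h0 h1 _) (hα₁ n hn hnj)
    · simp only [nabla, mul_zero, zero_mul, sub_self, smul_zero, norm_zero]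
      exact mul_pos (shrink_pos h0 h1 _) (hα₁ n hn hnj)

end RealMS

end Sect2

/-! ## §3b  The background proviso at the unit recipe -/

section BgUnit

variable (F : T4Family) (N : ℕ) [NeZero N] {𝔸 : Type*} [NormedRing 𝔸] [NormedAlgebra ℂ 𝔸] [CompleteSpace 𝔸]

/-- **THE BACKGROUND PROVISO (2.28) AT THE UNIT RECIPE ⟸ TWO SMALL-FIELD CONDITIONS ON THE BACKGROUND MAPS**: for every sequence `s`, retained `𝐖 ∈ Supp s`, scale
`1 ≤ j ≤ k` and `X ∈ 𝐃_j`: (hI) [I]'s condition (i) (1.11)–(1.12) for `ι ∘ U(s, 𝐖)` on the frame of `X` at radius `α₀(g_j)`; (h234) the (2.34) plaquette bounds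
on the layers of `X` along `s.Ω` and (h238) the (2.38) local gauges — given the model laws, the §2 signs and positive radii `α₀(g_j), α₁(g_j)`, `1 ≤ j ≤ k`.
[cite: Balaban1988Convergent, (2.28) p.259, (2.34)–(2.39) p.261; Balaban1987RG1, (1.11)–(1.16) p.262] -/
theorem bgProviso_unit_of_conds (K : ℕ) {S : Sect2.Setting 𝔸 (SU N)} (hS : S.Laws) (hpos : S.Pos) {ν : Stage7Numerics} (M : ℕ) {g : ℕ → ℝ} {n : ℕ}
    (k : ℕ) (Supp : SeqOfRecord F ν M g K n → Set (B15DeterminingSets.MSField (F.P K) (SU N))) (U : SeqOfRecord F ν M g K n → BgMap F N K)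
    (hα : ∀ j, 1 ≤ j → j ≤ k → 0 < S.lf.alpha0 (S.flow.g j) ∧ 0 < S.lf.alpha1 (S.flow.g j))
    (hI : ∀ s W, W ∈ Supp s → ∀ j, 1 ≤ j → j ≤ k → ∀ X : (Sect2.domSys (F.P K) M j).Dom,
      CondI S.𝓜 (Sect2.frameI (Sect2.Residual.unit (F.P K) 𝔸) M j (Sect2.domSites (F.P K) M j X)) (StepConsts.ofParams (F.P K) S.cB j)
        (S.lf.alpha0 (S.flow.g j)) (fun b => S.ι (U s W b)))
    (h234 : ∀ s W, W ∈ Supp s → ∀ j, 1 ≤ j → j ≤ k → ∀ X : (Sect2.domSys (F.P K) M j).Dom, ∀ m, 1 ≤ m → m ≤ j →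
      ∀ q ∈ (Sect2.regionOfSet (F.P K) (Sect2.layerSet j (Sect2.domSites (F.P K) M j X) s.Ω m)).plaqs,
        ‖(↑(plaq (fun b => S.ι (U s W b)) q) : 𝔸) - 1‖ < rad234 S.βc (S.lf.alpha0 (S.flow.g m)) ((F.P K).eta j) (F.P K).L j m)
    (h238 : ∀ s W, W ∈ Supp s → ∀ j, 1 ≤ j → j ≤ k → ∀ X : (Sect2.domSys (F.P K) M j).Dom,
      CondII238 S.𝓜 (Sect2.frameMS (Sect2.Residual.unit (F.P K) 𝔸) M j (Sect2.domSites (F.P K) M j X) s.Ω)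
        (MSConsts.ofParams (F.P K) S.βc S.B S.C S.Mr j) (fun m => S.lf.alpha0 (S.flow.g m)) (fun b => S.ι (U s W b))) :
    BgProviso F N K S (Sect2.Residual.unit (F.P K) 𝔸) M k Supp U := by
  intro s W hW j hj1 hjk X
  exact ⟨Sect2.Residual.ofBackgroundC_mem_spaceI_unit_of_condI S hS M j _ (hα j hj1 hjk).1 (hα j hj1 hjk).2 (U s W) (hI s W hW j hj1 hjk X),
    Sect2.Residual.ofBackgroundC_mem_spaceMS_unit_of_conds S hS hpos M j _ s.Ω (fun m hm hmj => (hα m hm (hmj.trans hjk)).1)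
      (fun m hm hmj => (hα m hm (hmj.trans hjk)).2) (U s W) (h234 s W hW j hj1 hjk X) (h238 s W hW j hj1 hjk X)⟩

end BgUnit

/-! ## §4  At the record: row P11 `bg` at any `θ` carrying K0b's residuals of record -/

section AtRecord

variable {F : T4Family} {N : ℕ} [NeZero N]

/-- **★ ROW P11 AT K0b's RESIDUAL OF RECORD, READ DOWN**: at any ADMISSIBLE `θ : Stage12Params` with `HasResidualsOfRecord θ` (so `θ.Rz = RzOfRecord F N`, the unit
recipe), the field `Provisos₁₂.bg` — VERBATIM — follows from the three DISPLAYED small-field conditions on def-R's background of record `ι ∘ UbgOfRecord₁₂ θ p n s 𝐖`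
(`ι = ιSU N`, the setting `settingOfRecord₁₂ θ p`: model `suModel N`, radii `α₀(g) = (lfOfRecord₁₂ θ).alpha0 g`, `α₁(g)`, along `gOfRecord₁₀ θ p`), for every run
`p`, length `n ≤ K` in the window `]0, γ]`, sequence `s`, retained `𝐖 ∈ suppOfRecord₁₂ θ p n s`, scale `1 ≤ j ≤ n`, `X ∈ 𝐃_j`: (hI) [I] (1.11)–(1.12) `CondI`;
(h234) [III] (2.34) on the layers along `s.Ω`; (h238) [III] (2.38) `CondII238`.  The radii are positive inside the window (12b `alphaPos₁₂_of_inInterval`), the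
signs are `Admissible.pos`.  At `n = 0` all three are vacuous (`1 ≤ j ≤ 0`), as is the field (12b `bgProviso_zero`); at `n + 1` the subject is def-R's
`UbgMSOfRecord` (12b `UbgOfRecord₁₂_succ`).  NOTHING is discharged: (hI)∕(h234)∕(h238) are print's [15] Thm 1 ∕ (2.7) regularity of the minimiser, row P11's content.
[cite: Balaban1988Convergent, (2.28) p.259, (2.34)–(2.39) p.261, (2.7) p.255; Balaban1987RG1, (1.11)–(1.16) p.262] -/
theorem Stage12Params.HasResidualsOfRecord.bg_of_conds {θ : Stage12Params F N} (hres : θ.HasResidualsOfRecord F N) (hθ : θ.Admissible F N)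
    (hI : ∀ (p : B12.RunParams) (n : ℕ), n ≤ p.K → Step.InInterval θ.γ n (gOfRecord₁₀ F N θ.toStage9Params p) →
      ∀ (s : SeqOfRecord F θ.ν θ.τ9.M (gOfRecord₁₀ F N θ.toStage9Params p) p.K n) (W : B15DeterminingSets.MSField (F.P p.K) (SU N)),
        W ∈ suppOfRecord₁₂ F N θ p n s → ∀ j, 1 ≤ j → j ≤ n → ∀ X : (Sect2.domSys (F.P p.K) θ.τ9.M j).Dom,
          CondI (settingOfRecord₁₂ F N θ p).𝓜 (Sect2.frameI (RzOfRecord F N p.K) θ.τ9.M j (Sect2.domSites (F.P p.K) θ.τ9.M j X))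
            (StepConsts.ofParams (F.P p.K) (settingOfRecord₁₂ F N θ p).cB j)
            ((settingOfRecord₁₂ F N θ p).lf.alpha0 ((settingOfRecord₁₂ F N θ p).flow.g j))
            (fun b => (settingOfRecord₁₂ F N θ p).ι (UbgOfRecord₁₂ F N θ p n s W b)))
    (h234 : ∀ (p : B12.RunParams) (n : ℕ), n ≤ p.K → Step.InInterval θ.γ n (gOfRecord₁₀ F N θ.toStage9Params p) →
      ∀ (s : SeqOfRecord F θ.ν θ.τ9.M (gOfRecord₁₀ F N θ.toStage9Params p) p.K n) (W : B15DeterminingSets.MSField (F.P p.K) (SU N)),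
        W ∈ suppOfRecord₁₂ F N θ p n s → ∀ j, 1 ≤ j → j ≤ n → ∀ X : (Sect2.domSys (F.P p.K) θ.τ9.M j).Dom, ∀ m, 1 ≤ m → m ≤ j →
          ∀ q ∈ (Sect2.regionOfSet (F.P p.K) (Sect2.layerSet j (Sect2.domSites (F.P p.K) θ.τ9.M j X) s.Ω m)).plaqs,
            ‖(↑(plaq (fun b => (settingOfRecord₁₂ F N θ p).ι (UbgOfRecord₁₂ F N θ p n s W b)) q) : MatA N) - 1‖ <
              rad234 (settingOfRecord₁₂ F N θ p).βc ((settingOfRecord₁₂ F N θ p).lf.alpha0 ((settingOfRecord₁₂ F N θ p).flow.g m))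
                ((F.P p.K).eta j) (F.P p.K).L j m)
    (h238 : ∀ (p : B12.RunParams) (n : ℕ), n ≤ p.K → Step.InInterval θ.γ n (gOfRecord₁₀ F N θ.toStage9Params p) →
      ∀ (s : SeqOfRecord F θ.ν θ.τ9.M (gOfRecord₁₀ F N θ.toStage9Params p) p.K n) (W : B15DeterminingSets.MSField (F.P p.K) (SU N)),
        W ∈ suppOfRecord₁₂ F N θ p n s → ∀ j, 1 ≤ j → j ≤ n → ∀ X : (Sect2.domSys (F.P p.K) θ.τ9.M j).Dom,
          CondII238 (settingOfRecord₁₂ F N θ p).𝓜 (Sect2.frameMS (RzOfRecord F N p.K) θ.τ9.M j (Sect2.domSites (F.P p.K) θ.τ9.M j X) s.Ω)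
            (MSConsts.ofParams (F.P p.K) (settingOfRecord₁₂ F N θ p).βc (settingOfRecord₁₂ F N θ p).B (settingOfRecord₁₂ F N θ p).C
              (settingOfRecord₁₂ F N θ p).Mr j)
            (fun m => (settingOfRecord₁₂ F N θ p).lf.alpha0 ((settingOfRecord₁₂ F N θ p).flow.g m))
            (fun b => (settingOfRecord₁₂ F N θ p).ι (UbgOfRecord₁₂ F N θ p n s W b))) :
    ∀ (p : B12.RunParams) (n : ℕ), n ≤ p.K → Step.InInterval θ.γ n (gOfRecord₁₀ F N θ.toStage9Params p) →
      BgProviso F N p.K (settingOfRecord₁₂ F N θ p) (θ.Rz p.K) θ.τ9.M n (suppOfRecord₁₂ F N θ p n) (UbgOfRecord₁₂ F N θ p n) := by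
  intro p n hn hw
  rw [hres.Rz_eq]
  exact bgProviso_unit_of_conds F N p.K (settingOfRecord₁₂_laws F N θ p) (settingOfRecord₁₂_pos F N θ hθ.pos p) θ.τ9.M n _ _
    (fun j _ hjn => alphaPos₁₂_of_inInterval hθ hw hjn) (hI p n hn hw) (h234 p n hn hw) (h238 p n hn hw)

end AtRecord

end Literature.MathematicalPhysics.QuantumFieldTheory.Balaban1983to89.Node00

end
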